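import Literature.Analysis.FluidPDE.DuchonRobertLocalBalance
import Literature.Analysis.FluidPDE.CoarseGrainingEstimates
import Literature.Analysis.FluidPDE.MollifiedLimits
import HarnessLib

/-!
# Torus kernels of a Euclidean mollifier: small support, Young, `L²` approximate identity, quadratic pairings

Analysis/FluidPDE support file for the discharge of the limit facts of
`Literature.Analysis.FluidPDE.DuchonRobertLocalBalance` (Duchon–Robert 2000, proof of Prop. 1,
p. 251, "letting `ε` go to `0`"): the torus kernels `K_ε = Torus.mollifierKernel φ ε` — the
periodisations onto `T^d` of the rescaled profiles `φ^ε = ε^{-d} φ(·/ε)` of a mollifier `φ`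
(`FluidPDE.IsMollifier`) — form an approximate identity on `T^d`, exactly as the intrinsic torus
mollifier `Torus.kernel ε` of `FunctionSpaces/TorusMollifier` does (the pattern of
`FluidPDE/OnsagerCCFSEnergyProofs` is followed). Everything is proved:

* `Torus.support_mollifierKernel_subset` — for `tsupport φ ⊆ closedBall 0 R` and `ε > 0`,
  `K_ε` is supported in the ball of radius `ε (R + 1)` of `T^d` (each lattice translate of a
  representative projects back to the point, and `proj` does not increase norms,
  `Torus.norm_proj_le`); `Torus.continuous_mollifierKernel`, `Torus.lintegral_enorm_mollifierKernel`;
* `Torus.eLpNorm_convolution_mollifierKernel_le`, `Torus.eLpNorm_vecConv_mollifierKernel_le` —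
  Young's inequality `‖θ ⋆ K_ε‖_p ≤ ‖θ‖_p` (real), `‖v ⋆ K_ε‖₂ ≤ (#d) ‖v‖₂` (vector fields,
  `Torus.vecConv`);
* `Torus.tendsto_eLpNorm_convolution_mollifierKernel_sub_self`,
  `Torus.tendsto_eLpNorm_vecConv_mollifierKernel_sub_self` — `θ ⋆ K_{εₙ} → θ` in `L²(T^d)` along
  `εₙ → 0⁺` (Evans, App. C.4, Thm. 7 (iv) on `T^d`, through the tree's
  `Torus.tendsto_eLpNorm_convolution_sub_self`: density of continuous functions, uniform
  continuity, Young);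
* quadratic pairings against a bounded weight `c`: the uniform bound
  `|∫ c f (f ⋆ K_ε)| ≤ C ∫ f²` (`Torus.abs_integral_mul_mul_convolution_le`) and the limit
  `∫ c f (f ⋆ K_{εₙ}) → ∫ c f²` (`Torus.tendsto_integral_mul_mul_convolution`, Hölder `2, 2`
  through `FluidPDE.tendsto_setIntegral_mul_bilin`); the component sums
  `∑ᵢ ∫ vᵢ² = ∫ ‖v‖²`, `∑ⱼ ∑ᵢ ∫ (G eⱼ)ᵢ² = ∫ |G|²` (`Torus.weakGradNormSq`) and their weighted forms;
* `Torus.aestronglyMeasurable_integral_mul_mul_convolution` — measurability in time of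
  `t ↦ ∫ c(t) f(t) (f(t) ⋆ K)` for jointly measurable `f`, `c` (Fubini).

These serve `DuchonRobertLocalBalanceViscousProofs` (discharge of `Torus.tendsto_viscous_pairing`)
and are shaped for the sibling facts `Torus.tendsto_mollified_transport`,
`Torus.tendsto_pressure_pairing` (which need the `L³`, `L^{3/2}` analogues of the `L²` limit).

## References

* L. C. Evans, *Partial Differential Equations*, 2nd ed. (AMS 2010), App. C.4, Thm. 7
  (properties of mollifiers: (iv) `f^ε → f` in `L^p_loc`, `1 ≤ p < ∞`). [Evans2010]
* L. C. Evans, R. F. Gariepy, *Measure Theory and Fine Properties of Functions*, rev. ed.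
  (CRC 2015), §4.2.1, Thm. 4.1 (iii), (v) — the same theorem with its proof (Young/Jensen bound,
  density of continuous functions), the printed text followed here. [EvansGariepy2015]
* J. Duchon, R. Robert, Nonlinearity 13 (2000) 249–255, proof of Prop. 1, p. 251. [DuchonRobert2000]

## Mathlib / tree search

Mathlib (this pin) has convolution on the compact abelian group `T^d` and Young-type bounds used
through the tree's `Torus.eLpNorm_convolution_le`; no periodised-mollifier API (searched
`mollifier`, `periodiz`, `approximate identity`). Tree: `Torus.mollifierKernel` and its evenness,
nonnegativity, unit mass, smoothness (`DuchonRobertLocalBalance`); the `Torus.kernel ε` versions of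
everything below (`OnsagerCCFSEnergyProofs`, `CoarseGrainingEstimates`), not applicable verbatim
because `K_ε` is a different kernel (arbitrary even profile, arbitrary `ε > 0`).
-/

noncomputable section

open MeasureTheory TopologicalSpace Set Function Filter Topology Metric
open scoped ENNReal NNReal Convolution ContDiff InnerProductSpace RealInnerProductSpace

namespace Literature.Analysis.FluidPDE.Torus

variable {d : Type*} [Fintype d] [DecidableEq d]

/-! ## The torus kernels of a mollifier: support, Young, approximate identity -/


section Kernel

variable {φ : EuclideanSpace ℝ d → ℝ} {R ε : ℝ}

omit [DecidableEq d] in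
/-- Off the closed ball of radius `ε R`, the rescaled mollifier `φ^ε` of a profile supported in
`closedBall 0 R` vanishes. [folklore] -/
theorem mollifierScale_eq_zero_of_lt (hR : tsupport φ ⊆ closedBall 0 R) (hε : 0 < ε)
    {ξ : EuclideanSpace ℝ d} (hξ : ε * R < ‖ξ‖) : FluidPDE.mollifierScale ε φ ξ = 0 := by
  rw [FluidPDE.mollifierScale_apply]
  have h : φ (ε⁻¹ • ξ) = 0 := by
    by_contra hne
    have hmem : ε⁻¹ • ξ ∈ closedBall (0 : EuclideanSpace ℝ d) R := hR (subset_tsupport _ hne)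
    rw [mem_closedBall, dist_zero_right, norm_smul, norm_inv, Real.norm_of_nonneg hε.le] at hmem
    have h' : ‖ξ‖ ≤ ε * R := by
      have h2 := mul_le_mul_of_nonneg_left hmem hε.le
      rwa [← mul_assoc, mul_inv_cancel₀ hε.ne', one_mul] at h2
    exact absurd hξ (not_lt.2 h')
  rw [h, mul_zero]

/-- Off the closed ball of radius `ε R` (torus norm), the torus kernel `K_ε` of a profile
supported in `closedBall 0 R` vanishes: each lattice translate `repr z + k` of the representative
projects to `z`, and the projection does not increase norms (`Torus.norm_proj_le`). [folklore] -/
theorem mollifierKernel_eq_zero_of_lt (hR : tsupport φ ⊆ closedBall 0 R) (hε : 0 < ε)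
    {z : UnitAddTorus d} (hz : ε * R < ‖z‖) : mollifierKernel φ ε z = 0 := by
  rw [mollifierKernel_apply, FunctionSpaces.Torus.perSum_apply]
  have h : ∀ k : d → ℤ, FluidPDE.mollifierScale ε φ
      (FunctionSpaces.Torus.repr z + FunctionSpaces.Torus.latticeVec k) = 0 := fun k => by
    refine mollifierScale_eq_zero_of_lt hR hε (hz.trans_le ?_)
    have hproj : FunctionSpaces.Torus.proj
        (FunctionSpaces.Torus.repr z + FunctionSpaces.Torus.latticeVec k) = z := by
      rw [FunctionSpaces.Torus.proj_add_latticeVec, FunctionSpaces.Torus.proj_repr]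
    calc ‖z‖ = ‖FunctionSpaces.Torus.proj
          (FunctionSpaces.Torus.repr z + FunctionSpaces.Torus.latticeVec k)‖ := by rw [hproj]
      _ ≤ _ := FunctionSpaces.Torus.norm_proj_le _
  simp only [h, tsum_zero]

/-- The torus kernel `K_ε` of a profile supported in `closedBall 0 R` is supported in the ball of
radius `ε (R + 1)` of `T^d`. [folklore] -/
theorem support_mollifierKernel_subset (hR : tsupport φ ⊆ closedBall 0 R) (hε : 0 < ε) :
    support (mollifierKernel φ ε) ⊆ ball (0 : UnitAddTorus d) (ε * (R + 1)) := by
  intro z hz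
  rw [mem_ball, dist_zero_right]
  by_contra hle
  refine hz (mollifierKernel_eq_zero_of_lt hR hε (lt_of_lt_of_le ?_ (not_lt.1 hle)))
  exact mul_lt_mul_of_pos_left (lt_add_one R) hε

/-- The torus kernel of a mollifier is continuous for `ε > 0`. [folklore] -/
theorem continuous_mollifierKernel (hφ : FluidPDE.IsMollifier φ) (hε : 0 < ε) :
    Continuous (mollifierKernel φ ε) :=
  (isSmooth_mollifierKernel hφ hε).continuous

/-- The torus kernel of a mollifier has unit `L¹` mass as an `ℝ≥0∞`-integral, for `ε > 0`. [folklore] -/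
theorem lintegral_enorm_mollifierKernel (hφ : FluidPDE.IsMollifier φ) (hε : 0 < ε) :
    ∫⁻ z, ‖mollifierKernel φ ε z‖ₑ = 1 := by
  rw [FunctionSpaces.Torus.lintegral_enorm_eq_ofReal_integral
    (continuous_mollifierKernel hφ hε).integrable_unitAddTorus (mollifierKernel_nonneg hφ hε.le),
    integral_mollifierKernel hφ hε, ENNReal.ofReal_one]

/-- **Young's inequality for the torus kernels of a mollifier**: `‖θ ⋆ K_ε‖_{Lᵖ} ≤ ‖θ‖_{Lᵖ}`,
`1 ≤ p`, `ε > 0` (unit mass, nonnegative kernel; `Torus.eLpNorm_convolution_le`). [folklore] -/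
theorem eLpNorm_convolution_mollifierKernel_le (hφ : FluidPDE.IsMollifier φ) (hε : 0 < ε)
    {θ : UnitAddTorus d → ℝ} (hθ : AEStronglyMeasurable θ volume) {p : ℝ≥0∞} (hp : 1 ≤ p) :
    eLpNorm (θ ⋆ mollifierKernel φ ε) p volume ≤ eLpNorm θ p volume := by
  have h := FunctionSpaces.Torus.eLpNorm_convolution_le hθ
    (continuous_mollifierKernel hφ hε).aestronglyMeasurable hp
  rwa [lintegral_enorm_mollifierKernel hφ hε, one_mul] at h

/-- **Young's inequality for vector mollification by the torus kernels of a mollifier, `L²`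
form**: `‖v ⋆ K_ε‖_{L²} ≤ (#d) ‖v‖_{L²}` (componentwise Young and `‖w‖ ≤ ∑ᵢ ‖wᵢ‖`,
`‖wᵢ‖ ≤ ‖w‖`; as `Torus.eLpNorm_vecConv_kernel_le`). [folklore] -/
theorem eLpNorm_vecConv_mollifierKernel_le (hφ : FluidPDE.IsMollifier φ) (hε : 0 < ε)
    {v : UnitAddTorus d → EuclideanSpace ℝ d} (hv : MemLp v 2 volume) :
    eLpNorm (vecConv v (mollifierKernel φ ε)) 2 volume ≤ Fintype.card d * eLpNorm v 2 volume := by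
  have hvi : ∀ i, Integrable (fun y => v y i) volume := fun i =>
    (EuclideanSpace.proj (𝕜 := ℝ) i).integrable_comp (hv.integrable one_le_two)
  have hKc : Continuous (mollifierKernel φ ε) := continuous_mollifierKernel hφ hε
  set Fi : d → UnitAddTorus d → ℝ := fun i x => ‖((fun y => v y i) ⋆ mollifierKernel φ ε) x‖
    with hFi
  have h1 : eLpNorm (vecConv v (mollifierKernel φ ε)) 2 volume ≤ eLpNorm (∑ i, Fi i) 2 volume := by
    refine eLpNorm_mono_real fun x => ?_
    rw [Finset.sum_apply]
    exact norm_le_sum_norm_apply _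
  have h2 : eLpNorm (∑ i, Fi i) 2 volume ≤ ∑ i, eLpNorm (Fi i) 2 volume :=
    eLpNorm_sum_le (fun i _ =>
      (FunctionSpaces.Torus.continuous_convolution (hvi i) hKc).norm.aestronglyMeasurable) one_le_two
  have h3 : ∀ i, eLpNorm (Fi i) 2 volume ≤ eLpNorm v 2 volume := fun i => by
    rw [hFi, eLpNorm_norm]
    refine (eLpNorm_convolution_mollifierKernel_le hφ hε (hvi i).aestronglyMeasurable
      one_le_two).trans ?_
    exact eLpNorm_mono fun x => PiLp.norm_apply_le (v x) i
  calc eLpNorm (vecConv v (mollifierKernel φ ε)) 2 volume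
      ≤ ∑ i, eLpNorm (Fi i) 2 volume := h1.trans h2
    _ ≤ ∑ _i : d, eLpNorm v 2 volume := Finset.sum_le_sum fun i _ => h3 i
    _ = Fintype.card d * eLpNorm v 2 volume := by simp

/-- **`L²` convergence of real mollification by the torus kernels of a mollifier** along
`εₙ → 0`, `εₙ > 0`: `‖θ ⋆ K_{εₙ} - θ‖_{L²} → 0` for `θ ∈ L²(T^d)` (Evans, App. C.4, Thm. 7 (iv)
on `T^d`: `Torus.tendsto_eLpNorm_convolution_sub_self`, the kernels being nonnegative, of unit
mass and supported in balls of radius `εₙ (R + 1)`). [folklore] -/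
theorem tendsto_eLpNorm_convolution_mollifierKernel_sub_self (hφ : FluidPDE.IsMollifier φ)
    {θ : UnitAddTorus d → ℝ} (hθ : MemLp θ 2 volume) {y : ℕ → ℝ} (hy : ∀ n, 0 < y n)
    (hy0 : Tendsto y atTop (𝓝 0)) :
    Tendsto (fun n => eLpNorm (θ ⋆ mollifierKernel φ (y n) - θ) 2 volume) atTop (𝓝 0) := by
  obtain ⟨R, hR⟩ := hφ.2.1.exists_tsupport_subset_closedBall
  refine FunctionSpaces.Torus.tendsto_eLpNorm_convolution_sub_self hθ
    (k := fun n => mollifierKernel φ (y n)) (δ := fun n => y n * (R + 1))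
    (fun n z => mollifierKernel_nonneg hφ (hy n).le z) (fun n => integral_mollifierKernel hφ (hy n))
    (fun n => support_mollifierKernel_subset hR (hy n))
    (fun n => continuous_mollifierKernel hφ (hy n)) ?_
  simpa using hy0.mul_const (R + 1)

/-- **`L²` convergence of vector mollification by the torus kernels of a mollifier** along
`εₙ → 0`, `εₙ > 0`: `‖v ⋆ K_{εₙ} - v‖_{L²} → 0` for `v ∈ L²(T^d; ℝ^d)` (componentwise). [folklore] -/
theorem tendsto_eLpNorm_vecConv_mollifierKernel_sub_self (hφ : FluidPDE.IsMollifier φ)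
    {v : UnitAddTorus d → EuclideanSpace ℝ d} (hv : MemLp v 2 volume) {y : ℕ → ℝ}
    (hy : ∀ n, 0 < y n) (hy0 : Tendsto y atTop (𝓝 0)) :
    Tendsto (fun n => eLpNorm (vecConv v (mollifierKernel φ (y n)) - v) 2 volume) atTop (𝓝 0) := by
  have hvi2 : ∀ i, MemLp (fun y => v y i) 2 volume := fun i =>
    (EuclideanSpace.proj (𝕜 := ℝ) i).comp_memLp' hv
  set Fi : ℕ → d → UnitAddTorus d → ℝ := fun n i x =>
    ‖((fun y => v y i) ⋆ mollifierKernel φ (y n)) x - v x i‖ with hFi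
  have hsum : Tendsto (fun n => ∑ i, eLpNorm (Fi n i) 2 volume) atTop (𝓝 0) := by
    have h0 : Tendsto (fun n => ∑ i, eLpNorm (Fi n i) 2 volume) atTop
        (𝓝 (∑ _i : d, (0 : ℝ≥0∞))) := by
      refine tendsto_finsetSum _ fun i _ => ?_
      have h := tendsto_eLpNorm_convolution_mollifierKernel_sub_self hφ (hvi2 i) hy hy0
      refine h.congr fun n => ?_
      rw [hFi, eLpNorm_norm]
      rfl
    simpa using h0
  refine tendsto_of_tendsto_of_tendsto_of_le_of_le tendsto_const_nhds hsum
    (fun n => bot_le) fun n => ?_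
  have hle : eLpNorm (vecConv v (mollifierKernel φ (y n)) - v) 2 volume ≤
      eLpNorm (∑ i, Fi n i) 2 volume := by
    refine eLpNorm_mono_real fun x => ?_
    rw [Finset.sum_apply]
    refine (norm_le_sum_norm_apply _).trans (le_of_eq (Finset.sum_congr rfl fun i _ => ?_))
    simp [hFi, vecConv]
  refine hle.trans (eLpNorm_sum_le (fun i _ => ?_) one_le_two)
  exact ((FunctionSpaces.Torus.continuous_convolution ((hvi2 i).integrable one_le_two)
    (continuous_mollifierKernel hφ (hy n))).aestronglyMeasurable.sub (hvi2 i).1).norm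

end Kernel

/-! ## Pairings at a fixed time: limits and bounds -/

section Pairing

variable {φ : EuclideanSpace ℝ d → ℝ} {ε : ℝ}

omit [DecidableEq d] in
/-- For `g ∈ L²(T^d)` real, `∫ g² = ‖g‖²_{L²}` (real form). [folklore] -/
theorem integral_sq_eq_toReal_eLpNorm_sq_of_memLp {g : UnitAddTorus d → ℝ} (hg : MemLp g 2 volume) :
    ∫ x, g x ^ 2 = (eLpNorm g 2 volume).toReal ^ 2 := by
  have h := hg.eLpNorm_eq_integral_rpow_norm two_ne_zero ENNReal.ofNat_ne_top
  have hint : ∫ x, ‖g x‖ ^ (2 : ℝ≥0∞).toReal = ∫ x, g x ^ 2 := by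
    refine integral_congr_ae (Eventually.of_forall fun x => ?_)
    simp only [ENNReal.toReal_ofNat, Real.rpow_two, Real.norm_eq_abs, sq_abs]
  rw [hint, ENNReal.toReal_ofNat] at h
  have hI : 0 ≤ ∫ x, g x ^ 2 := integral_nonneg fun _ => sq_nonneg _
  rw [h, ENNReal.toReal_ofReal (by positivity)]
  conv_rhs => rw [← Real.rpow_two, ← Real.rpow_mul hI, inv_mul_cancel₀ two_ne_zero,
    Real.rpow_one]

omit [DecidableEq d] in
/-- Continuous real functions on the torus are in `L²`. [folklore] -/
theorem memLp_two_of_continuous {g : UnitAddTorus d → ℝ} (hg : Continuous g) : MemLp g 2 volume :=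
  hg.memLp_of_hasCompactSupport (HasCompactSupport.of_compactSpace g)

/-- **Bound for the mollified quadratic pairing**: for `f ∈ L²(T^d)`, a weight `|c| ≤ C` and
`ε > 0`, `|∫ c f (f ⋆ K_ε)| ≤ C ∫ f²` (`2|f||f ⋆ K_ε| ≤ f² + (f ⋆ K_ε)²` and Young's inequality
`‖f ⋆ K_ε‖₂ ≤ ‖f‖₂`). [folklore] -/
theorem abs_integral_mul_mul_convolution_le (hφ : FluidPDE.IsMollifier φ) (hε : 0 < ε)
    {f : UnitAddTorus d → ℝ} (hf : MemLp f 2 volume) {c : UnitAddTorus d → ℝ} {C : ℝ}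
    (hC0 : 0 ≤ C) (hC : ∀ x, ‖c x‖ ≤ C) :
    |∫ x, c x * (f x * (f ⋆ mollifierKernel φ ε) x)| ≤ C * ∫ x, f x ^ 2 := by
  set g : UnitAddTorus d → ℝ := f ⋆ mollifierKernel φ ε with hg_def
  have hgc : Continuous g :=
    FunctionSpaces.Torus.continuous_convolution (hf.integrable one_le_two)
      (continuous_mollifierKernel hφ hε)
  have hf2 : Integrable (fun x => f x ^ 2) volume := hf.integrable_sq
  have hg2 : Integrable (fun x => g x ^ 2) volume := (memLp_two_of_continuous hgc).integrable_sq
  have hY : ∫ x, g x ^ 2 ≤ ∫ x, f x ^ 2 := by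
    rw [integral_sq_eq_toReal_eLpNorm_sq hgc, integral_sq_eq_toReal_eLpNorm_sq_of_memLp hf]
    exact toReal_sq_le_toReal_sq hf.eLpNorm_ne_top
      (eLpNorm_convolution_mollifierKernel_le hφ hε hf.1 one_le_two)
  calc |∫ x, c x * (f x * g x)| ≤ ∫ x, |c x * (f x * g x)| := abs_integral_le_integral_abs
    _ ≤ ∫ x, C / 2 * (f x ^ 2 + g x ^ 2) := by
        refine integral_mono_of_nonneg (ae_of_all _ fun x => abs_nonneg _)
          ((hf2.add hg2).const_mul (C / 2)) (ae_of_all _ fun x => ?_)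
        dsimp only
        rw [abs_mul, abs_mul]
        have h1 : |c x| ≤ C := by simpa [Real.norm_eq_abs] using hC x
        have h2 : 2 * (|f x| * |g x|) ≤ f x ^ 2 + g x ^ 2 := by
          nlinarith [sq_nonneg (|f x| - |g x|), sq_abs (f x), sq_abs (g x)]
        nlinarith [abs_nonneg (c x), abs_nonneg (f x), abs_nonneg (g x),
          mul_nonneg (abs_nonneg (f x)) (abs_nonneg (g x))]
    _ = C / 2 * ((∫ x, f x ^ 2) + ∫ x, g x ^ 2) := by
        rw [integral_const_mul, integral_add hf2 hg2]
    _ ≤ C / 2 * ((∫ x, f x ^ 2) + ∫ x, f x ^ 2) := by gcongr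
    _ = C * ∫ x, f x ^ 2 := by ring

/-- **Limit of the mollified quadratic pairing** (Evans, App. C.4, Thm. 7 (iv), paired): for
`f ∈ L²(T^d)`, a bounded measurable weight `c` and `εₙ → 0⁺`,
`∫ c f (f ⋆ K_{εₙ}) → ∫ c f²` (Hölder `2, 2` against the `L²` convergence `f ⋆ K_{εₙ} → f`;
`FluidPDE.tendsto_setIntegral_mul_bilin`). [folklore] -/
theorem tendsto_integral_mul_mul_convolution (hφ : FluidPDE.IsMollifier φ)
    {f : UnitAddTorus d → ℝ} (hf : MemLp f 2 volume) {c : UnitAddTorus d → ℝ} {C : ℝ}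
    (hcm : AEStronglyMeasurable c volume) (hC : ∀ x, ‖c x‖ ≤ C) {y : ℕ → ℝ}
    (hy : ∀ n, 0 < y n) (hy0 : Tendsto y atTop (𝓝 0)) :
    Tendsto (fun n => ∫ x, c x * (f x * (f ⋆ mollifierKernel φ (y n)) x)) atTop
      (𝓝 (∫ x, c x * (f x * f x))) := by
  have hB : ∀ n, MemLp (f ⋆ mollifierKernel φ (y n)) 2 volume := fun n =>
    memLp_two_of_continuous (FunctionSpaces.Torus.continuous_convolution
      (hf.integrable one_le_two) (continuous_mollifierKernel hφ (hy n)))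
  have hAt : Tendsto (fun _ : ℕ => eLpNorm (f - f) 2 volume) atTop (𝓝 0) := by
    simp only [sub_self, eLpNorm_zero, tendsto_const_nhds]
  have h := tendsto_setIntegral_mul_bilin (p := 2) (q := 2) (μ := volume) one_le_two
    (ContinuousLinearMap.mul ℝ ℝ) (A := fun _ => f) (A₀ := f)
    (B := fun n => f ⋆ mollifierKernel φ (y n)) (B₀ := f) (fun _ => hf) hf hB hf hAt
    (tendsto_eLpNorm_convolution_mollifierKernel_sub_self hφ hf hy hy0) hcm (ae_of_all _ hC) univ
  simpa only [Measure.restrict_univ, ContinuousLinearMap.mul_apply'] using h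

omit [DecidableEq d] in
/-- `∑ᵢ ∫ vᵢ² = ∫ ‖v‖²` for `v ∈ L²(T^d; ℝ^d)`. [folklore] -/
theorem sum_integral_apply_sq {v : UnitAddTorus d → EuclideanSpace ℝ d} (hv : MemLp v 2 volume) :
    ∑ i, ∫ x, v x i ^ 2 = ∫ x, ‖v x‖ ^ 2 := by
  rw [← integral_finsetSum _ fun i _ => (hv.eval_piLp i).integrable_sq]
  refine integral_congr_ae (ae_of_all _ fun x => ?_)
  dsimp only
  rw [EuclideanSpace.real_norm_sq_eq]

omit [DecidableEq d] in
/-- `∑ᵢ ∫ c vᵢ vᵢ = ∫ ‖v‖² c` for `v ∈ L²(T^d; ℝ^d)` and a bounded measurable weight `c`. [folklore] -/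
theorem sum_integral_mul_apply_mul_apply {v : UnitAddTorus d → EuclideanSpace ℝ d}
    (hv : MemLp v 2 volume) {c : UnitAddTorus d → ℝ} {C : ℝ} (hcm : AEStronglyMeasurable c volume)
    (hC : ∀ x, ‖c x‖ ≤ C) :
    ∑ i, ∫ x, c x * (v x i * v x i) = ∫ x, ‖v x‖ ^ 2 * c x := by
  have hint : ∀ i, Integrable (fun x => c x * (v x i * v x i)) volume := fun i => by
    have h := ((hv.eval_piLp i).integrable_sq).bdd_mul hcm (ae_of_all _ hC)
    exact h.congr (ae_of_all _ fun x => by simp [sq])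
  rw [← integral_finsetSum _ fun i _ => hint i]
  refine integral_congr_ae (ae_of_all _ fun x => ?_)
  dsimp only
  rw [EuclideanSpace.real_norm_sq_eq, ← Finset.mul_sum, mul_comm]
  simp [sq]

/-- Slices of the weak gradient: `∑ⱼ ∑ᵢ ∫ c (G eⱼ)ᵢ (G eⱼ)ᵢ = ∫ |G|² c` when every `G eⱼ ∈ L²` and
`c` is a bounded measurable weight (`weakGradNormSq_eq_sum`). [folklore] -/
theorem sum_sum_integral_mul_apply_mul_apply
    {Gt : UnitAddTorus d → EuclideanSpace ℝ d →L[ℝ] EuclideanSpace ℝ d}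
    (hG : ∀ j, MemLp (fun x => Gt x (EuclideanSpace.single j 1)) 2 volume)
    {c : UnitAddTorus d → ℝ} {C : ℝ} (hcm : AEStronglyMeasurable c volume) (hC : ∀ x, ‖c x‖ ≤ C) :
    ∑ j, ∑ i, ∫ x, c x * (Gt x (EuclideanSpace.single j 1) i * Gt x (EuclideanSpace.single j 1) i) =
      ∫ x, weakGradNormSq Gt x * c x := by
  have h1 : ∀ j, ∑ i, ∫ x, c x *
      (Gt x (EuclideanSpace.single j 1) i * Gt x (EuclideanSpace.single j 1) i) =
        ∫ x, ‖Gt x (EuclideanSpace.single j 1)‖ ^ 2 * c x := fun j =>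
    sum_integral_mul_apply_mul_apply (hG j) hcm hC
  have hint : ∀ j, Integrable (fun x => ‖Gt x (EuclideanSpace.single j 1)‖ ^ 2 * c x) volume :=
    fun j => ((memLp_two_iff_integrable_sq_norm (hG j).1).1 (hG j)).mul_bdd hcm (ae_of_all _ hC)
  rw [Finset.sum_congr rfl fun j _ => h1 j, ← integral_finsetSum _ fun j _ => hint j]
  refine integral_congr_ae (ae_of_all _ fun x => ?_)
  dsimp only
  rw [weakGradNormSq_eq_sum, Finset.sum_mul]

/-- Slices of the weak gradient: `∑ⱼ ∑ᵢ ∫ (G eⱼ)ᵢ² = ∫ |G|²`. [folklore] -/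
theorem sum_sum_integral_apply_sq
    {Gt : UnitAddTorus d → EuclideanSpace ℝ d →L[ℝ] EuclideanSpace ℝ d}
    (hG : ∀ j, MemLp (fun x => Gt x (EuclideanSpace.single j 1)) 2 volume) :
    ∑ j, ∑ i, ∫ x, Gt x (EuclideanSpace.single j 1) i ^ 2 = ∫ x, weakGradNormSq Gt x := by
  have hint : ∀ j, Integrable (fun x => ‖Gt x (EuclideanSpace.single j 1)‖ ^ 2) volume :=
    fun j => (memLp_two_iff_integrable_sq_norm (hG j).1).1 (hG j)
  rw [Finset.sum_congr rfl fun j _ => sum_integral_apply_sq (hG j),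
    ← integral_finsetSum _ fun j _ => hint j]
  refine integral_congr_ae (ae_of_all _ fun x => ?_)
  dsimp only
  rw [weakGradNormSq_eq_sum]

end Pairing

/-! ## Measurability in time of the mollified pairings -/

section Measurability

omit [DecidableEq d] in
/-- For jointly measurable `f`, `c` on `S × T^d` and a continuous kernel `K`, the pairing
`t ↦ ∫ c(t) f(t) (f(t) ⋆ K)` is a.e.-strongly measurable in time (Fubini; the mollified field
is jointly measurable, `Torus.aestronglyMeasurable_uncurry_convolution`). [folklore] -/
theorem aestronglyMeasurable_integral_mul_mul_convolution {μ : Measure ℝ} [SFinite μ]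
    {f c : ℝ → UnitAddTorus d → ℝ} (hf : AEStronglyMeasurable (uncurry f) (μ.prod volume))
    (hc : AEStronglyMeasurable (uncurry c) (μ.prod volume)) {K : UnitAddTorus d → ℝ}
    (hK : Continuous K) :
    AEStronglyMeasurable (fun t => ∫ x, c t x * (f t x * (f t ⋆ K) x)) μ := by
  have hconv : AEStronglyMeasurable (uncurry fun t x => (f t ⋆ K) x) (μ.prod volume) :=
    FunctionSpaces.Torus.aestronglyMeasurable_uncurry_convolution (ContinuousLinearMap.lsmul ℝ ℝ)
      hf hK
  have h : AEStronglyMeasurable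
      (fun z : ℝ × UnitAddTorus d => c z.1 z.2 * (f z.1 z.2 * (f z.1 ⋆ K) z.2)) (μ.prod volume) :=
    hc.mul (hf.mul hconv)
  exact h.integral_prod_right'

end Measurability

end Literature.Analysis.FluidPDE.Torus
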